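import Summits.BirchSwinnertonDyer.Rank1Residual.Additive.KatoDescentDatum
import HarnessLib

/-!
# The RANK-ONE count over a Kato descent datum, GRANTED the Perrin-Riou 'Kato point' formula at the
# additive prime (T-O6-A1′) — ONE hypothesis schema (THEOREM-CANDIDATE bookkeeping + a CONJECTURAL input),
# part 3 of the descent `KMC_p(f_E)⁰ ⟺ BSD_p` (cell `bsd-potss`, seat `kmc`; consumer
# `Additive/KMCTrivialDescentRankOne.lean`)

HONEST FRAMING (cell `bsd-potss`, `run/shared/lean/pub/bsd-potss/`; memo of record
`pub/bsd-potss/bsd-potss-kmc/KMC-DESCENT-MEMO.md` §4): NOTHING is asserted. This file defines ONE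
hypothesis schema over the interface predicate `IsOf` of `Additive/KatoDescentDatum.lean`. Unlike the
rank-`0` schema `DescentCountReading` (every clause a PRINTED theorem applied to `T_pW`), the rank-`1`
schema below CONTAINS A CONJECTURAL INPUT — Perrin-Riou's formula for the position of Kato's zeta
element in `E(ℚ) ⊗ ℚ_p` AT AN ADDITIVE PRIME (the O6 lane's sub-conjecture T-O6-A1′, interface `PRKato`
of `O6.RankOneOfKMC`; in print ONLY at good or multiplicative `p`: Bertolini–Darmon–Venerucci for good
ordinary `p`, Büyükboduk–Pollack–Sasaki for good supersingular `p`, Venerucci for split multiplicative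
`p`) — wrapped together with a Poitou–Tate count that is a THEOREM-CANDIDATE (derivation complete from
printed theorems, UNREVIEWED; memo §4 (R1-a)–(R1-f)). It is therefore EVIDENCE-shaped (conjecture-containing) as a
whole, and is kept in its own file so that no printed-theorem reading depends on it. Census numbers are
not inputs; nothing is booked; no mark of `RESIDUAL-MAP.md` moves.

## The derivation the schema packages (memo §4; `r_an = 1`, `p ≠ 2` additive potentially good, (12.5.2),
## `Ш(E)` finite and `rank E(ℚ) = 1` by Gross–Zagier–Kolyvagin, `E(ℚ) = ℤP ⊕ tors`, `p ∤ #tors`)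

(R1-a) `H¹(G_S,T) ≅ ℤ_p` is GENERATED by the Kummer class `κ(P)` (`dim H¹(G_S,V) = 1 + dim Ш¹(V) = 1`;
`H¹(G_S,T)_tors = E(ℚ)[p^∞] = 0`; `P ∉ pE(ℚ)`), and `𝔥 := H¹(ℤ[1/p], j_*T) = p^a ℤ_p κ(P)` with `p^a` the
order of the image of `P` in `⊕_{ℓ≠p} Φ_ℓ(𝔽_ℓ)[p^∞]`; every class of `𝔥` is Bloch–Kato-`f`, so the
first term of Kato's (14.9.3) vanishes: `0 → H¹(ℚ_p,T)/H¹_f → S(T)^∨ → H²(ℤ[1/p],T) → H²(ℚ_p,T) → 0`.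
(R1-b) `H²(ℤ[1/p], j_*T)` is FINITE and `#H²(ℤ[1/p],T) = p^t · #S_str(T)`, `p^t = #E(ℚ_p)[p^∞]`,
`S_str(T) = {x ∈ S(T) : x_p = 0}` (Pontryagin duality; the dual map is `loc_p : S(T) → E(ℚ_p)⊗ℚ_p/ℤ_p`).
(R1-c) `#S_str(T) = p^e · #(S(T)/E(ℚ)⊗ℚ_p/ℤ_p)`, `p^e := [E(ℚ_p)/tors ⊗ ℤ_p : ℤ_p·loc P]`.
(R1-d) `#(S(T)/E(ℚ)⊗ℚ_p/ℤ_p) = #Ш[p^∞] · (∏_{ℓ≠p} c_ℓ^{(p)})/p^a` — Poitou–Tate for the Selmer structures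
Kummer `⊂` (unramified at `ℓ ≠ p`): Rubin, *Euler Systems*, Thm. 1.7.3, with `Sel_{ℱ*}(T) = ℤ_pκ(P)`,
`Sel_{ℱ′*}(T) = 𝔥`, and `#H¹_ur(ℚ_ℓ,E[p^∞]) = c_ℓ^{(p)}` (Greenberg LNM 1716 §3). [Rank `0`: `a = 0`,
this is Lemma T.]
(R1-e) The tree's descent theorem `Kato2004.index_zeta_eq_natCard_coinvariants_of_conj_12_10` applies
VERBATIM (it never used `L(E,1) ≠ 0`, only the finiteness of `𝐇²/T𝐇² = H²(ℤ[1/p],T)`): Conj. 12.10⁰ ⇒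
`z ≠ 0` in `H¹(ℤ[1/p],V) = ℚ_pκ(P)` (Perrin-Riou's NON-VANISHING for free) and `[𝔥 : z] = #H²(ℤ[1/p],T)`.
With `z = λ·κ(P)`, `λ ∈ ℚ_p^×`, and Kato's `μ = p^m` (Thm. 14.5 (3), no `L`-hypothesis in the case
`r = k/2`): `[𝔥 : z] = p^{v(λ) − a} = p^m · #H²`, i.e. **`v(λ) = m + t + e + v_p #Ш + Σ_{ℓ≠p} v_p c_ℓ`**
(`a` CANCELS).
(R1-g) CONJECTURAL INPUT T-O6-A1′ (Perrin-Riou at the additive `p`): `λ = u · (L′(E,1)/(Ω(W)·Reg(W))) ·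
log_ω(P)`, `u ∈ ℤ_p^×` (Euler-type factor `1` at an additive `p`); with the local index
`log_ω(E(ℚ_p) ⊗ ℤ_p) = p^{t − v_p(c_p)} ℤ_p` (Lemma A, `O6.integralLogAdditive_holds`;
`Kato2004/LocalIndexSkeletonProofs.lean`): `v(log_ω P) = e + t − v_p(c_p)`, hence
**`v_p(L′(E,1)/(Ω·Reg)) = v_p #Ш + v_p(Tam E) + m`** — `e`, `t`, `a` all cancelled — and, since
`#Ш_an = L′(E,1)·#tors²/(Ω·Tam·Reg)` with `p ∤ #tors`, **`ord_p #Ш_an = ord_p #Ш + m`**: the SAME shape as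
the rank-`0` reading. (`L′(E,1)/(Ω·Reg) ∈ ℚ` by Gross–Zagier; the schema asks for `#Ш_an ∈ ℚ` directly.)
NO `p`-adic height enters: in the `𝐇²`-formalism the order of vanishing lives in `𝐇¹/Z` at the bottom
layer (`exp* loc_p z = L(E,1)/Ω·ω = 0`), not in `𝐇²`; the interface `HtNondeg` of `O6.RankOneOfKMC` is
idle on the (12.5.2) rows.

References: K. Kato, Astérisque 295 (2004): Thm. 12.5 (4), (12.5.2) (p. 222), Conj. 12.10 (p. 224),
Thm. 14.5 (3) (p. 236), (14.9.3) (p. 240), §14.14 (p. 243) [Kato2004Asterisque]; K. Rubin, *Euler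
Systems*, Thm. 1.7.3 [Rubin2000]; R. Greenberg, LNM 1716 §3 [GreenbergLNM1716];
M. Bertolini, H. Darmon, R. Venerucci, *Heegner points and Beilinson–Kato elements: a conjecture of
Perrin-Riou*, Adv. Math. 398 (2022) [BertoliniDarmonVenerucci2022] (the formula at GOOD ordinary `p` —
cited as the printed shape of the conjectural input, not as an input); B. Perrin-Riou, Ann. Inst.
Fourier 43 (1993) §3.3 (the conjecture) [PerrinRiou1993AIF].
-/

set_option autoImplicit false

noncomputable section

open scoped Classical

open WeierstrassCurve Literature.NumberTheory.EllipticCurves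
  Literature.NumberTheory.EllipticCurves.Rank1Residual
  Literature.NumberTheory.EllipticCurves.Rank1Residual.Typed
  Literature.NumberTheory.EllipticCurves.IwasawaAlgebra

namespace Summit.BirchSwinnertonDyer.Rank1Residual.Additive

variable (IsOf : ∀ (W : WeierstrassCurve ℚ) [W.IsElliptic] [W.IsGloballyMinimal] (p : ℕ) [Fact p.Prime],
  KatoDescentDatum p → Prop)

/-- **READING 1′ (rank ONE) — the Poitou–Tate count over a realised Kato descent datum GRANTED the
Perrin-Riou 'Kato point' formula at the additive prime (CONJECTURAL input T-O6-A1′; the rest a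
THEOREM-CANDIDATE derivation, memo §4 (R1-a)–(R1-g), module docstring).** For `W/ℚ` globally minimal
of analytic rank `1`, `p ≠ 2` additive and potentially good, (12.5.2), `Ш(E)` finite, and a realised
datum `D`: `H²(ℤ[1/p],T)` is finite, and WHENEVER `[H¹(ℤ[1/p],T) : z] = p^m · #H²(ℤ[1/p],T)` (so the
zeta element survives at the bottom layer; `m ≥ 0` exists by the tree's module-theoretic Thm. 14.5 (3),
`Kato2004.exists_index_zeta_eq_pow_mul_natCard_coinvariants_of_index_ne_zero`, and `m = 0` under
Conj. 12.10⁰ by the tree's descent theorem), there is `q ∈ ℚ` with `#Ш_an(W) = q` and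
**`ord_p #Ш(W)(p) + m = ord_p q`**. EVIDENCE-shaped (conjecture-containing) hypothesis schema (it
contains T-O6-A1′); nothing asserted. [cite: Kato2004Asterisque, (14.9.3) (p. 240), Thm. 14.5 (3) (p. 236), §14.14 (p. 243)]
[cite: Rubin2000, Thm. 1.7.3] [cite: GreenbergLNM1716, §3 after Lemma 3.3]
[cite: PerrinRiou1993AIF, §3.3] -/
def RankOnePRCountReading : Prop :=
  ∀ (W : WeierstrassCurve ℚ) [W.IsElliptic] [W.IsGloballyMinimal] (p : ℕ) [Fact p.Prime]
    (D : KatoDescentDatum p),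
    W.analyticRank = 1 → p ≠ 2 → Addv W p → 0 ≤ padicValRat p W.j → Kato2004.ImageContainsSL2 W p →
    Finite W.sha → IsOf W p D →
    Finite (coinvariants p D.H2) ∧
      ∀ m : ℕ, D.zetaIndex = p ^ m * D.h2Card →
        ∃ q : ℚ, shaAn W = (q : ℂ) ∧
          (padicValNat p (Nat.card (AddCommGroup.primaryComponent W.sha p)) : ℤ) + m = padicValRat p q

end Summit.BirchSwinnertonDyer.Rank1Residual.Additive

end
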